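import Literature.Geometry.Lorentzian.KerrDeSitterRadialTSDualityThreeHalves
import Literature.Geometry.Lorentzian.KerrDeSitterRadialTSCosmoLimitThreeHalves
import Literature.Geometry.Lorentzian.KerrDeSitterRadialTSEventLimitThreeHalves
import Literature.Geometry.Lorentzian.KerrDeSitterRadialTSConstantThreeHalves
import HarnessLib

/-!
# Half-integer spin `|s| = 3/2` on the real axis, VIII: the spin-`(−3/2)` theorem (CTdC Theorem
# 3.10, fermionic real-axis clause at `s = −3/2`, in the Teukolsky–Starobinsky-coercive region)

On subextremal Kerr–de Sitter, a classical solution `R` of the spin-`(−3/2)` radial Teukolsky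
equation on `(r₊, r_c)` with REAL `ω` and REAL `λ`, ingoing at `𝓗⁺` and outgoing at `𝓗⁺_c`,
vanishes identically as soon as `Re ℭ_{3/2}(λ̄) ≥ 0`, `λ̄ = lambdaBar a Λ (−3/2) ω m λ`
(`radial_negThreeHalves_real_eq_zero_of_coercive`). PROOF BY DUALITY (file VII), no new energy
identity: `S(t) = Δ_r(−t)^{−3/2}·R(−t)` solves on `(−r_c, −r₊)` the generic spin-`(+3/2)` equation
of files I–V for the reflected quartic (`d₁ = +2M`) with `λ̃ = Re λ + (10/3)(1−α)`; the outgoing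
branch of `R` at `r_c` becomes the singular branch of `S` at `−r_c`, the ingoing branch of `R` at
`r₊` the regular branch of `S` at `−r₊` (factor `σ_{r₊}(−t)^{−3/2}·f(−t)`), so files II, III, V give
a constant form with limits `−ℭ·(−Δ_r′(r_c))/(1/4 + 4β_c²)·|f_S(−r_c)|² ≤ 0` and
`c·σ_{r₊}(r₊)^{−3}|f(r₊)|²`, `c > 0`; hence `f(r₊) = 0` and unique continuation at `r₊`
(`radial_eq_zero_of_eventAmplitude_eq_zero`, `s < 1`) concludes. The constant is the SAME cubic
`ℭ_{3/2}` (`tsqTSConst_kds_neg`). Definitions with bodies + theorems, NO named facts.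

Sources: [CasalsTeixeiradacosta2022] Theorem 3.10 (second bullet) and Definition 3.3;
[Costa2019] Proposition 2.21; [WuYan2004] Appendix A (A4)–(A6); [SuzukiTakasugiUmetsu1998] (3.7).
-/

noncomputable section

open Complex Set Filter Topology

open scoped ComplexConjugate

namespace Literature.Geometry.Lorentzian.KerrDeSitter

/-! ### Dictionary at spin `−3/2` -/

/-- The shifted separation constant of the generic spin-`(−3/2)` numerator on Kerr–de Sitter:
`λ̃₋ = Re λ + (10/3)(1 − α)` (`−(2Λ/3)r² − 3(1−α) − λ = Δ_r″/6 − λ̃₋`).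
[cite: SuzukiTakasugiUmetsu1998, (3.7)] -/
def kdsElNeg (a Λ : ℝ) (lam : ℂ) : ℝ := lam.re + 10 / 3 * (1 - alpha a Λ)

/-- **The spin-`(−3/2)` radial coefficient, regrouped.** For real `ω`, `λ`:
`Δ_r·V_{−3/2} = N₋ = Re N₋ + i·Im N₋`, `Re N₋ = K̃² + Δ_r(Δ_r″/6 − λ̃₋)`,
`Im N₋ = (3/2)K̃Δ_r′ − 3Δ_rK̃′`. [cite: SuzukiTakasugiUmetsu1998, (3.7)] -/
theorem radialPotential_negThreeHalves_mul_delta (M a Λ : ℝ) {ω : ℂ} (hω : ω.im = 0) (m : ℝ)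
    {lam : ℂ} (hlam : lam.im = 0) {r : ℝ} (hΔ : delta M a Λ r ≠ 0) :
    radialPotential M a Λ (-(3 / 2)) ω m lam r * (delta M a Λ r : ℂ) =
      (tsqNMre (a ^ 2) (-(2 * M)) (1 - Λ / 3 * a ^ 2) (-(Λ / 3)) (kdsK0 a Λ ω m) (kdsK2 a Λ ω)
          (kdsElNeg a Λ lam) r : ℂ) +
        I * (tsqNMim (a ^ 2) (-(2 * M)) (1 - Λ / 3 * a ^ 2) (-(Λ / 3)) (kdsK0 a Λ ω m)
          (kdsK2 a Λ ω) r : ℂ) := by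
  have hΔc : (delta M a Λ r : ℂ) ≠ 0 := by exact_mod_cast hΔ
  have hωr : ω = ((ω.re : ℝ) : ℂ) := Complex.ext (by simp) (by simp [hω])
  have hlamr : lam = ((lam.re : ℝ) : ℂ) := Complex.ext (by simp) (by simp [hlam])
  have step : radialPotential M a Λ (-(3 / 2)) ω m lam r * (delta M a Λ r : ℂ) =
      ((xi a Λ : ℂ) ^ 2 * radialK a ω m r ^ 2 -
          I * ((-(3 / 2) : ℝ) : ℂ) * (xi a Λ : ℂ) * radialK a ω m r * (deltaDeriv M a Λ r : ℂ)) +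
        (4 * I * ((-(3 / 2) : ℝ) : ℂ) * (xi a Λ : ℂ) * ω * (r : ℂ) -
            ((2 * Λ / 3 * (-(3 / 2) + 1) * (2 * (-(3 / 2)) + 1) * r ^ 2 : ℝ) : ℂ) +
            ((2 * (-(3 / 2)) * (1 - alpha a Λ) : ℝ) : ℂ) - lam) * (delta M a Λ r : ℂ) := by
    unfold radialPotential
    field_simp
    ring
  rw [step, hωr, hlamr]
  simp only [kdsK0, kdsK2, kdsElNeg, tsqNMre, tsqNMim, tsqK, tsqDelta, tsqDeltaD, tsqDeltaDD,
    radialK, delta, deltaDeriv, xi, alpha, ofReal_re]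
  push_cast
  ring

/-- The tree's pointwise spin-`(−3/2)` radial equation at real `ω`, `λ` in the generic polynomial
form `Δ²R″ − (1/2)ΔΔ′R′ + N₋R = 0`. [cite: SuzukiTakasugiUmetsu1998, (3.7)] -/
theorem tsq_ode_of_radialNegThreeHalves {M a Λ : ℝ} {ω : ℂ} {m : ℝ} {lam : ℂ}
    {R R' R'' : ℝ → ℂ} {r : ℝ} (hω : ω.im = 0) (hlam : lam.im = 0) (hΔ : delta M a Λ r ≠ 0)
    (heq : (delta M a Λ r : ℂ) * R'' r +
      ((-(3 / 2) + 1 : ℝ) : ℂ) * (deltaDeriv M a Λ r : ℂ) * R' r +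
        radialPotential M a Λ (-(3 / 2)) ω m lam r * R r = 0) :
    (tsqDelta (a ^ 2) (-(2 * M)) (1 - Λ / 3 * a ^ 2) (-(Λ / 3)) r : ℂ) ^ 2 * R'' r -
      1 / 2 * (tsqDelta (a ^ 2) (-(2 * M)) (1 - Λ / 3 * a ^ 2) (-(Λ / 3)) r : ℂ) *
          (tsqDeltaD (-(2 * M)) (1 - Λ / 3 * a ^ 2) (-(Λ / 3)) r : ℂ) * R' r +
        ((tsqNMre (a ^ 2) (-(2 * M)) (1 - Λ / 3 * a ^ 2) (-(Λ / 3)) (kdsK0 a Λ ω m) (kdsK2 a Λ ω)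
              (kdsElNeg a Λ lam) r : ℂ) +
          I * (tsqNMim (a ^ 2) (-(2 * M)) (1 - Λ / 3 * a ^ 2) (-(Λ / 3)) (kdsK0 a Λ ω m)
              (kdsK2 a Λ ω) r : ℂ)) * R r = 0 := by
  have hV := radialPotential_negThreeHalves_mul_delta M a Λ hω m hlam hΔ
  rw [← delta_eq_tsqDelta, ← deltaDeriv_eq_tsqDeltaD, ← hV]
  have h := congrArg (fun z => z * (delta M a Λ r : ℂ)) heq
  simp only [zero_mul] at h
  push_cast at h
  linear_combination h

/-- The generic Teukolsky–Starobinsky constant is even in `d₁` (invariant under the reflection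
`Δ(t) ↦ Δ(−t)`). [cite: WuYan2004, Appendix A, (A6)] -/
theorem tsqTSConst_reflect (d₀ d₁ d₂ d₄ k₀ k₂ el : ℝ) :
    tsqTSConst d₀ (-d₁) d₂ d₄ k₀ k₂ el = tsqTSConst d₀ d₁ d₂ d₄ k₀ k₂ el := by
  unfold tsqTSConst; ring

/-- **The constant at spin `−3/2` on Kerr–de Sitter**: the generic constant at
`λ̃₋ = Re λ + (10/3)(1−α)` is `Re ℭ_{3/2}(λ̄)` at `λ̄ = lambdaBar a Λ (−3/2) ω m λ` — the same cubic
as at spin `+3/2`, the tree's spin-`(−3/2)` `λ` entering through `λ + 3(1−α)`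
(`tsRadialConstantThreeHalves_lambdaBar_neg`). [cite: WuYan2004, Appendix A, (A4) and (A6)] -/
theorem tsqTSConst_kds_neg (M a Λ : ℝ) {ω : ℂ} (hω : ω.im = 0) (m : ℝ) {lam : ℂ}
    (hlam : lam.im = 0) :
    tsqTSConst (a ^ 2) (-(2 * M)) (1 - Λ / 3 * a ^ 2) (-(Λ / 3)) (kdsK0 a Λ ω m) (kdsK2 a Λ ω)
        (kdsElNeg a Λ lam) =
      (tsRadialConstantThreeHalves M a Λ ω m (lambdaBar a Λ (-(3 / 2)) ω m lam)).re := by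
  have hωr : ω = ((ω.re : ℝ) : ℂ) := Complex.ext (by simp) (by simp [hω])
  have hlamr : lam = ((lam.re : ℝ) : ℂ) := Complex.ext (by simp) (by simp [hlam])
  have key : tsRadialConstantThreeHalves M a Λ ω m (lambdaBar a Λ (-(3 / 2)) ω m lam) =
      ((tsqTSConst (a ^ 2) (-(2 * M)) (1 - Λ / 3 * a ^ 2) (-(Λ / 3)) (kdsK0 a Λ ω m)
        (kdsK2 a Λ ω) (kdsElNeg a Λ lam) : ℝ) : ℂ) := by
    rw [tsRadialConstantThreeHalves_lambdaBar_neg]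
    conv_lhs => rw [hωr, hlamr]
    simp only [tsqTSConst, kdsK0, kdsK2, kdsElNeg, alpha, xi]
    push_cast
    ring
  rw [key, ofReal_re]

/-! ### The theorem at spin `−3/2` -/

/-- **CTdC Theorem 3.10, fermionic real-axis clause at `s = −3/2`, in its domain of validity
(`ℭ_{3/2}(λ̄) ≥ 0`) — PROVED, by duality from the spin-`(+3/2)` machinery.** On subextremal
Kerr–de Sitter let `R` be a classical solution of the spin-`(−3/2)` radial Teukolsky equation on
`(r₊, r_c)` with REAL `ω` (any, including `ω = 0`) and REAL `λ` with `Re ℭ_{3/2}(λ̄) ≥ 0`,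
`λ̄ = lambdaBar a Λ (−3/2) ω m λ` (`ℭ_{3/2} = tsRadialConstantThreeHalves`, Wu–Yan's `|C_{3/2}|²`),
ingoing at `𝓗⁺` and outgoing at `𝓗⁺_c` (generic exponents). Then `R ≡ 0` on `(r₊, r_c)`.
Mechanism: the dual function `S(t) = Δ_r(−t)^{−3/2}R(−t)` solves the generic spin-`(+3/2)`
equation of the reflected quartic on `(−r_c, −r₊)`; its Teukolsky–Starobinsky form is constant with
limits `−Re ℭ_{3/2}·(−Δ_r′(r_c))/(1/4 + 4β_c²)·|f_S(−r_c)|² ≤ 0` at `−r_c` and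
`c·σ(r₊)^{−3}|f(r₊)|²`, `c > 0`, at `−r₊`; so the event-horizon amplitude `f(r₊)` vanishes and
`radial_eq_zero_of_eventAmplitude_eq_zero` concludes. No window / rotation / `m` condition.
[cite: CasalsTeixeiradacosta2022, Theorem 3.10 (second bullet, |s| = 3/2) with Costa2019
Proposition 2.21 and WuYan2004 Appendix A (A4)] -/
theorem radial_negThreeHalves_real_eq_zero_of_coercive {M a Λ : ℝ} {ω : ℂ} {m : ℝ} {lam : ℂ}
    (hsub : IsSubextremal M a Λ) (hω : ω.im = 0) (hlam : lam.im = 0)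
    (hcoer : 0 ≤ (tsRadialConstantThreeHalves M a Λ ω m (lambdaBar a Λ (-(3 / 2)) ω m lam)).re)
    {R : ℝ → ℂ} (hR : IsRadialTeukolskySolution M a Λ (-(3 / 2)) ω m lam R)
    (hin : IsIngoingAtEventHorizon M a Λ (-(3 / 2)) ω m R)
    (hout : IsOutgoingAtCosmoHorizon M a Λ ω m R) :
    ∀ r ∈ Ioo (rPlus M a Λ) (rCosmo M a Λ), R r = 0 := by
  have hd1 := deltaDeriv_rPlus_pos hsub
  have hd2 := deltaDeriv_rCosmo_neg hsub
  have hd2ne : deltaDeriv M a Λ (rCosmo M a Λ) ≠ 0 := hd2.ne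
  have hsub' := hsub
  obtain ⟨-, -, -, h12, hΔ1, hΔ2, -, hΔpos, -⟩ := hsub
  have hωim : 0 ≤ ω.im := le_of_eq hω.symm
  obtain ⟨R', R'', hode⟩ := id hR
  obtain ⟨ε₁, hε₁, f, hf, hRf⟩ := hin
  obtain ⟨ε₂, hε₂, g, hg, hRg⟩ := hout
  obtain ⟨d₀, hd₀⟩ : ∃ d : ℝ, d = a ^ 2 := ⟨_, rfl⟩
  obtain ⟨d₁, hd₁⟩ : ∃ d : ℝ, d = -(2 * M) := ⟨_, rfl⟩
  obtain ⟨d₂, hd₂⟩ : ∃ d : ℝ, d = 1 - Λ / 3 * a ^ 2 := ⟨_, rfl⟩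
  obtain ⟨d₄, hd₄⟩ : ∃ d : ℝ, d = -(Λ / 3) := ⟨_, rfl⟩
  obtain ⟨k₀, hk₀⟩ : ∃ k : ℝ, k = kdsK0 a Λ ω m := ⟨_, rfl⟩
  obtain ⟨k₂, hk₂⟩ : ∃ k : ℝ, k = kdsK2 a Λ ω := ⟨_, rfl⟩
  obtain ⟨el, hel⟩ : ∃ e : ℝ, e = kdsElNeg a Λ lam := ⟨_, rfl⟩
  have hΔeq : ∀ x, delta M a Λ x = tsqDelta d₀ d₁ d₂ d₄ x := by
    intro x; rw [hd₀, hd₁, hd₂, hd₄]; exact delta_eq_tsqDelta M a Λ x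
  have hDeq : ∀ x, deltaDeriv M a Λ x = tsqDeltaD d₁ d₂ d₄ x := by
    intro x; rw [hd₁, hd₂, hd₄]; exact deltaDeriv_eq_tsqDeltaD M a Λ x
  have hq₁ : tsqDelta d₀ d₁ d₂ d₄ (rPlus M a Λ) = 0 := by rw [← hΔeq]; exact hΔ1
  have hq₂ : tsqDelta d₀ d₁ d₂ d₄ (rCosmo M a Λ) = 0 := by rw [← hΔeq]; exact hΔ2
  -- `K` at the horizons is real: `B = iβ`
  obtain ⟨Kp, hKp⟩ : ∃ Kp : ℝ, Kp = (radialK a ω m (rPlus M a Λ)).re := ⟨_, rfl⟩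
  obtain ⟨Kc, hKc⟩ : ∃ Kc : ℝ, Kc = (radialK a ω m (rCosmo M a Λ)).re := ⟨_, rfl⟩
  have hKreal₁ : radialK a ω m (rPlus M a Λ) = (Kp : ℂ) := by
    rw [hKp]; exact Complex.ext (by simp) (by simp [im_radialK_of_real a hω m (rPlus M a Λ)])
  have hKreal₂ : radialK a ω m (rCosmo M a Λ) = (Kc : ℂ) := by
    rw [hKc]; exact Complex.ext (by simp) (by simp [im_radialK_of_real a hω m (rCosmo M a Λ)])
  obtain ⟨γ₁, hγ₁⟩ : ∃ γ : ℝ, γ = xi a Λ * Kp / deltaDeriv M a Λ (rPlus M a Λ) := ⟨_, rfl⟩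
  obtain ⟨γ₂, hγ₂⟩ : ∃ γ : ℝ, γ = xi a Λ * Kc / deltaDeriv M a Λ (rCosmo M a Λ) := ⟨_, rfl⟩
  have hwK₁ : horizonB M a Λ ω m (rPlus M a Λ) = I * (γ₁ : ℂ) := by
    simp only [horizonB]
    rw [hKreal₁, hγ₁]
    push_cast
    field_simp
  have hwK₂ : horizonB M a Λ ω m (rCosmo M a Λ) = I * (γ₂ : ℂ) := by
    simp only [horizonB]
    rw [hKreal₂, hγ₂]
    push_cast
    field_simp
  have hKt₁ : tsqK k₀ k₂ (rPlus M a Λ) = xi a Λ * Kp := by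
    rw [hk₀, hk₂, hKp]
    simp only [tsqK, kdsK0, kdsK2, radialK, sub_re, mul_re, ofReal_re, ofReal_im, mul_zero,
      sub_zero]
    ring
  have hKt₂ : tsqK k₀ k₂ (rCosmo M a Λ) = xi a Λ * Kc := by
    rw [hk₀, hk₂, hKc]
    simp only [tsqK, kdsK0, kdsK2, radialK, sub_re, mul_re, ofReal_re, ofReal_im, mul_zero,
      sub_zero]
    ring
  -- the reflected quartic on `J = (−r_c, −r₊)` and at its endpoints
  have hΔJ : ∀ t ∈ Ioo (-rCosmo M a Λ) (-rPlus M a Λ), tsqDelta d₀ (-d₁) d₂ d₄ t ≠ 0 := by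
    intro t ht
    rw [← tsqDelta_neg, ← hΔeq]
    exact (hΔpos (-t) ⟨by linarith [ht.2], by linarith [ht.1]⟩).ne'
  have hΔp₁ : tsqDelta d₀ (-d₁) d₂ d₄ (-rPlus M a Λ) = 0 := by
    rw [← tsqDelta_neg, neg_neg]; exact hq₁
  have hΔp₂ : tsqDelta d₀ (-d₁) d₂ d₄ (-rCosmo M a Λ) = 0 := by
    rw [← tsqDelta_neg, neg_neg]; exact hq₂
  have hDp₁ : tsqDeltaD (-d₁) d₂ d₄ (-rPlus M a Λ) = -deltaDeriv M a Λ (rPlus M a Λ) := by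
    rw [tsqDeltaD_reflect, ← hDeq]
  have hDp₂ : tsqDeltaD (-d₁) d₂ d₄ (-rCosmo M a Λ) = -deltaDeriv M a Λ (rCosmo M a Λ) := by
    rw [tsqDeltaD_reflect, ← hDeq]
  have hβ₁ : -γ₁ * tsqDeltaD (-d₁) d₂ d₄ (-rPlus M a Λ) = tsqK k₀ k₂ (-rPlus M a Λ) := by
    rw [hDp₁, tsqK_neg, hKt₁, hγ₁]
    field_simp
  have hβ₂ : -γ₂ * tsqDeltaD (-d₁) d₂ d₄ (-rCosmo M a Λ) = tsqK k₀ k₂ (-rCosmo M a Λ) := by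
    rw [hDp₂, tsqK_neg, hKt₂, hγ₂]
    field_simp
  -- the dual function solves the spin-`(+3/2)` equation of the reflected quartic on `J`
  have hodeS : ∀ t ∈ Ioo (-rCosmo M a Λ) (-rPlus M a Λ),
      HasDerivAt (fun u => tsqDual d₀ d₁ d₂ d₄ R u) (tsqDualD d₀ d₁ d₂ d₄ R R' t) t ∧
      HasDerivAt (fun u => tsqDualD d₀ d₁ d₂ d₄ R R' u) (tsqDualDD d₀ d₁ d₂ d₄ R R' R'' t) t ∧
      (tsqDelta d₀ (-d₁) d₂ d₄ t : ℂ) ^ 2 * tsqDualDD d₀ d₁ d₂ d₄ R R' R'' t +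
        5 / 2 * (tsqDelta d₀ (-d₁) d₂ d₄ t : ℂ) * (tsqDeltaD (-d₁) d₂ d₄ t : ℂ) *
          tsqDualD d₀ d₁ d₂ d₄ R R' t +
        ((tsqNVre d₀ (-d₁) d₂ d₄ k₀ k₂ el t : ℂ) + I * (tsqNVim d₀ (-d₁) d₂ d₄ k₀ k₂ t : ℂ)) *
          tsqDual d₀ d₁ d₂ d₄ R t = 0 := by
    intro t ht
    have hy : -t ∈ Ioo (rPlus M a Λ) (rCosmo M a Λ) := ⟨by linarith [ht.2], by linarith [ht.1]⟩
    obtain ⟨h1, h2, heq⟩ := hode (-t) hy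
    have hΔy : 0 < tsqDelta d₀ d₁ d₂ d₄ (-t) := by rw [← hΔeq]; exact hΔpos (-t) hy
    have heq' := tsq_ode_of_radialNegThreeHalves hω hlam (hΔpos (-t) hy).ne' heq
    rw [← hd₂, ← hd₄, ← hd₀, ← hd₁, ← hk₀, ← hk₂, ← hel] at heq'
    refine ⟨hasDerivAt_tsqDual hΔy h1, hasDerivAt_tsqDualD hΔy h1 h2, ?_⟩
    simpa only [neg_neg] using tsq_dual_ode hΔy heq'
  have hS' : ∀ t ∈ Ioo (-rCosmo M a Λ) (-rPlus M a Λ),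
      HasDerivAt (fun u => tsqDual d₀ d₁ d₂ d₄ R u) (tsqDualD d₀ d₁ d₂ d₄ R R' t) t :=
    fun t ht => (hodeS t ht).1
  -- the singular branch of `S` at `−r_c` from the outgoing branch of `R` at `r_c`
  obtain ⟨δ₂, hδ₂, hσ₂⟩ := exists_tsqCofactor_sign (d₁ := d₁) (d₂ := d₂) (d₄ := d₄) (c := -1)
    (q := rCosmo M a Λ) (by rw [tsqCofactor_self, ← hDeq]; linarith)
  obtain ⟨ε₂', hε₂'⟩ : ∃ e : ℝ, e = min ε₂ δ₂ := ⟨_, rfl⟩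
  have hε₂'pos : 0 < ε₂' := by rw [hε₂']; exact lt_min hε₂ hδ₂
  have hε₂'le : ε₂' ≤ ε₂ := by rw [hε₂']; exact min_le_left _ _
  have hε₂'le' : ε₂' ≤ δ₂ := by rw [hε₂']; exact min_le_right _ _
  have hσneg : ∀ x ∈ Ioo (rCosmo M a Λ - ε₂') (rCosmo M a Λ + ε₂'),
      tsqCofactor d₁ d₂ d₄ (rCosmo M a Λ) x < 0 := by
    intro x hx
    have h := hσ₂ x ⟨by linarith [hx.1], by linarith [hx.2]⟩
    linarith
  have hRg' : ∀ x ∈ Ioo (rCosmo M a Λ - ε₂') (rCosmo M a Λ),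
      R x * ((rCosmo M a Λ - x : ℝ) : ℂ) ^ (-(I * (γ₂ : ℂ))) = g x := by
    intro x hx
    rw [← hwK₂]
    exact hRg x ⟨by linarith [hx.1], hx.2⟩
  obtain ⟨fS, hfS_def⟩ : ∃ F : ℝ → ℂ, F = fun t =>
      (((-tsqCofactor d₁ d₂ d₄ (rCosmo M a Λ) (-t)) ^ (-(3 / 2 : ℝ)) : ℝ) : ℂ) * g (-t) :=
    ⟨_, rfl⟩
  have hfS : ContDiffOn ℝ ((⊤ : ℕ∞) : WithTop ℕ∞) fS
      (Ioo (-rCosmo M a Λ - ε₂') (-rCosmo M a Λ + ε₂')) := by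
    rw [hfS_def]
    exact contDiffOn_tsqDual_singular_factor
      (hg.mono (Ioo_subset_Ioo (by linarith) (by linarith))) hσneg
  have hRfS : ∀ t ∈ Ioo (-rCosmo M a Λ) (-rCosmo M a Λ + ε₂'),
      tsqDual d₀ d₁ d₂ d₄ R t * ((t - -rCosmo M a Λ : ℝ) : ℂ) ^
        ((((3 / 2 : ℝ)) : ℂ) + I * (((-γ₂ : ℝ)) : ℂ)) = fS t := by
    intro t ht
    rw [hfS_def]
    exact tsqDual_singular_branch hq₂ hRg' (fun x hx => hσneg x ⟨hx.1, by linarith [hx.2]⟩) ht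
  have hlim₁ := tendsto_tsqForm_singular (el := el) hΔp₂ (by rw [hDp₂]; exact neg_ne_zero.2 hd2.ne)
    hβ₂ (by linarith : -rCosmo M a Λ < -rPlus M a Λ) hΔJ hodeS hε₂'pos hfS hRfS
  -- the regular branch of `S` at `−r₊` from the ingoing branch of `R` at `r₊`
  obtain ⟨δ₁, hδ₁, hσ₁⟩ := exists_tsqCofactor_sign (d₁ := d₁) (d₂ := d₂) (d₄ := d₄) (c := 1)
    (q := rPlus M a Λ) (by rw [tsqCofactor_self, ← hDeq]; linarith)
  obtain ⟨ε₁', hε₁'⟩ : ∃ e : ℝ, e = min ε₁ δ₁ := ⟨_, rfl⟩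
  have hε₁'pos : 0 < ε₁' := by rw [hε₁']; exact lt_min hε₁ hδ₁
  have hε₁'le : ε₁' ≤ ε₁ := by rw [hε₁']; exact min_le_left _ _
  have hε₁'le' : ε₁' ≤ δ₁ := by rw [hε₁']; exact min_le_right _ _
  have hσpos : ∀ x ∈ Ioo (rPlus M a Λ - ε₁') (rPlus M a Λ + ε₁'),
      0 < tsqCofactor d₁ d₂ d₄ (rPlus M a Λ) x := by
    intro x hx
    have h := hσ₁ x ⟨by linarith [hx.1], by linarith [hx.2]⟩
    linarith
  have hRf' : ∀ x ∈ Ioo (rPlus M a Λ) (rPlus M a Λ + ε₁'),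
      R x * ((x - rPlus M a Λ : ℝ) : ℂ) ^ ((((-(3 / 2) : ℝ)) : ℂ) + I * (γ₁ : ℂ)) = f x := by
    intro x hx
    rw [← hwK₁]
    exact hRf x ⟨hx.1, by linarith [hx.2]⟩
  obtain ⟨gS, hgS_def⟩ : ∃ G : ℝ → ℂ, G = fun t =>
      (((tsqCofactor d₁ d₂ d₄ (rPlus M a Λ) (-t)) ^ (-(3 / 2 : ℝ)) : ℝ) : ℂ) * f (-t) :=
    ⟨_, rfl⟩
  have hgS : ContDiffOn ℝ ((⊤ : ℕ∞) : WithTop ℕ∞) gS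
      (Ioo (-rPlus M a Λ - ε₁') (-rPlus M a Λ + ε₁')) := by
    rw [hgS_def]
    exact contDiffOn_tsqDual_regular_factor
      (hf.mono (Ioo_subset_Ioo (by linarith) (by linarith))) hσpos
  have hRgS : ∀ t ∈ Ioo (-rPlus M a Λ - ε₁') (-rPlus M a Λ),
      tsqDual d₀ d₁ d₂ d₄ R t * ((-rPlus M a Λ - t : ℝ) : ℂ) ^ (-(I * (((-γ₁ : ℝ)) : ℂ))) =
        gS t := by
    intro t ht
    rw [hgS_def]
    exact tsqDual_regular_branch hq₁ hRf' (fun x hx => hσpos x ⟨by linarith [hx.1], hx.2⟩) ht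
  have hlim₂ := tendsto_tsqForm_regular (el := el) hΔp₁ hβ₁
    (by linarith : -rCosmo M a Λ < -rPlus M a Λ) hS' hε₁'pos hgS hRgS
  -- conservation on `J`: the two limits agree
  have hQd : ∀ t ∈ Ioo (-rCosmo M a Λ) (-rPlus M a Λ),
      HasDerivAt (fun y => tsqForm d₀ (-d₁) d₂ d₄ k₀ k₂ el y (tsqDual d₀ d₁ d₂ d₄ R y)
        (tsqDualD d₀ d₁ d₂ d₄ R R' y)) 0 t := by
    intro t ht
    obtain ⟨h1, h2, heq⟩ := hodeS t ht
    exact hasDerivAt_tsqForm (hΔJ t ht) h1 h2 heq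
  have hLeq : -(tsqTSConst d₀ (-d₁) d₂ d₄ k₀ k₂ el * tsqDeltaD (-d₁) d₂ d₄ (-rCosmo M a Λ)) /
        (1 / 4 + 4 * (-γ₂) ^ 2) * normSq (fS (-rCosmo M a Λ)) =
      (4 * tsqK k₀ k₂ (-rPlus M a Λ) ^ 2 + tsqDeltaD (-d₁) d₂ d₄ (-rPlus M a Λ) ^ 2 / 4) *
        (4 * tsqK k₀ k₂ (-rPlus M a Λ) ^ 2 + 9 / 4 * tsqDeltaD (-d₁) d₂ d₄ (-rPlus M a Λ) ^ 2) *
        normSq (gS (-rPlus M a Λ)) := by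
    obtain ⟨c, -, hc⟩ := exists_ratio_hasDerivAt_eq_ratio_slope'
      (f := fun y => tsqForm d₀ (-d₁) d₂ d₄ k₀ k₂ el y (tsqDual d₀ d₁ d₂ d₄ R y)
        (tsqDualD d₀ d₁ d₂ d₄ R R' y))
      (f' := fun _ => (0 : ℝ)) (by linarith : -rCosmo M a Λ < -rPlus M a Λ) (g := id)
      (g' := fun _ => (1 : ℝ))
      (lfa := -(tsqTSConst d₀ (-d₁) d₂ d₄ k₀ k₂ el * tsqDeltaD (-d₁) d₂ d₄ (-rCosmo M a Λ)) /
        (1 / 4 + 4 * (-γ₂) ^ 2) * normSq (fS (-rCosmo M a Λ)))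
      (lga := -rCosmo M a Λ)
      (lfb := (4 * tsqK k₀ k₂ (-rPlus M a Λ) ^ 2 + tsqDeltaD (-d₁) d₂ d₄ (-rPlus M a Λ) ^ 2 / 4) *
        (4 * tsqK k₀ k₂ (-rPlus M a Λ) ^ 2 + 9 / 4 * tsqDeltaD (-d₁) d₂ d₄ (-rPlus M a Λ) ^ 2) *
        normSq (gS (-rPlus M a Λ)))
      (lgb := -rPlus M a Λ)
      (fun x hx => hQd x hx) (fun x _ => hasDerivAt_id x) hlim₁
      ((continuous_id.tendsto _).mono_left nhdsWithin_le_nhds) hlim₂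
      ((continuous_id.tendsto _).mono_left nhdsWithin_le_nhds)
    simp only [mul_zero, mul_one] at hc
    linarith
  -- signs: the `−r_c` value is `≤ 0` (`ℭ ≥ 0`, `−Δ_r′(r_c) > 0`), the `−r₊` weight is `> 0`
  have hC : tsqTSConst d₀ (-d₁) d₂ d₄ k₀ k₂ el =
      (tsRadialConstantThreeHalves M a Λ ω m (lambdaBar a Λ (-(3 / 2)) ω m lam)).re := by
    rw [tsqTSConst_reflect, hd₀, hd₁, hd₂, hd₄, hk₀, hk₂, hel]
    exact tsqTSConst_kds_neg M a Λ hω m hlam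
  have hneg : -(tsqTSConst d₀ (-d₁) d₂ d₄ k₀ k₂ el * tsqDeltaD (-d₁) d₂ d₄ (-rCosmo M a Λ)) /
        (1 / 4 + 4 * (-γ₂) ^ 2) * normSq (fS (-rCosmo M a Λ)) ≤ 0 := by
    rw [hC, hDp₂]
    have h1 : 0 ≤ (tsRadialConstantThreeHalves M a Λ ω m (lambdaBar a Λ (-(3 / 2)) ω m lam)).re *
        -deltaDeriv M a Λ (rCosmo M a Λ) := mul_nonneg hcoer (by linarith)
    have h2 : 0 < 1 / 4 + 4 * (-γ₂) ^ 2 := by positivity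
    exact mul_nonpos_of_nonpos_of_nonneg (div_nonpos_of_nonpos_of_nonneg (by linarith) h2.le)
      (normSq_nonneg _)
  have hwpos : 0 < (4 * tsqK k₀ k₂ (-rPlus M a Λ) ^ 2 +
        tsqDeltaD (-d₁) d₂ d₄ (-rPlus M a Λ) ^ 2 / 4) *
      (4 * tsqK k₀ k₂ (-rPlus M a Λ) ^ 2 + 9 / 4 * tsqDeltaD (-d₁) d₂ d₄ (-rPlus M a Λ) ^ 2) := by
    rw [hDp₁]
    have hD2 : 0 < (-deltaDeriv M a Λ (rPlus M a Λ)) ^ 2 := by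
      rw [neg_sq]; exact pow_pos hd1 2
    have hK2 : 0 ≤ tsqK k₀ k₂ (-rPlus M a Λ) ^ 2 := sq_nonneg _
    have h1 : 0 < 4 * tsqK k₀ k₂ (-rPlus M a Λ) ^ 2 +
        (-deltaDeriv M a Λ (rPlus M a Λ)) ^ 2 / 4 := by linarith
    have h2 : 0 < 4 * tsqK k₀ k₂ (-rPlus M a Λ) ^ 2 +
        9 / 4 * (-deltaDeriv M a Λ (rPlus M a Λ)) ^ 2 := by linarith
    exact mul_pos h1 h2
  have hgS0 : gS (-rPlus M a Λ) = 0 := by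
    have hY : 0 ≤ normSq (gS (-rPlus M a Λ)) := normSq_nonneg _
    have hY0 : normSq (gS (-rPlus M a Λ)) = 0 := by
      by_contra hN
      have hpos : 0 < normSq (gS (-rPlus M a Λ)) := lt_of_le_of_ne hY (Ne.symm hN)
      have := mul_pos hwpos hpos
      linarith
    exact Complex.normSq_eq_zero.1 hY0
  -- hence the event-horizon amplitude of `R` vanishes
  have hf0 : f (rPlus M a Λ) = 0 := by
    have hσ0 : 0 < tsqCofactor d₁ d₂ d₄ (rPlus M a Λ) (rPlus M a Λ) :=
      hσpos _ ⟨by linarith, by linarith⟩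
    have hne : (((tsqCofactor d₁ d₂ d₄ (rPlus M a Λ) (rPlus M a Λ)) ^ (-(3 / 2 : ℝ)) : ℝ) : ℂ) ≠
        0 := by
      exact_mod_cast (Real.rpow_pos_of_pos hσ0 _).ne'
    have h := hgS0
    rw [hgS_def] at h
    simp only [neg_neg] at h
    exact (mul_eq_zero.1 h).resolve_left hne
  exact radial_eq_zero_of_eventAmplitude_eq_zero hsub' hωim (by norm_num) hR hε₁ hf hRf hf0

/-! ### Packaging with CTdC's binder `Im λ̄ = 0` and a coercivity clause -/

/-- **The Teukolsky–Starobinsky coercivity clause for the fermionic real-axis case at `s = −3/2`**: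
`s = −3/2` and `Re ℭ_{3/2}(λ̄) ≥ 0`, `λ̄ = lambdaBar a Λ (−3/2) ω m λ` (the twin of
`FermionicTSCoerciveThreeHalves`). [cite: Costa2019, Proposition 2.21] -/
def FermionicTSCoerciveNegThreeHalves (M a Λ s : ℝ) (ω : ℂ) (m : ℝ) (lam : ℂ) : Prop :=
  s = -(3 / 2) ∧ 0 ≤ (tsRadialConstantThreeHalves M a Λ ω m (lambdaBar a Λ (-(3 / 2)) ω m lam)).re

/-- **CTdC Theorem 3.10, fermionic real-axis clause at `s = −3/2`, in the Teukolsky–Starobinsky-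
coercive region — PROVED, packaged with CTdC's binder `Im λ̄ = 0`.** On subextremal Kerr–de Sitter:
`Im ω = 0`, `Im λ̄ = 0`, `FermionicTSCoerciveNegThreeHalves M a Λ s ω m λ` ⟹ every classical radial
Teukolsky solution on `(r₊, r_c)` ingoing at `𝓗⁺` and outgoing at `𝓗⁺_c` vanishes identically.
[cite: CasalsTeixeiradacosta2022, Theorem 3.10 (second bullet, |s| = 3/2) with Costa2019
Proposition 2.21] -/
theorem radial_real_eq_zero_of_fermionicTSCoerciveNegThreeHalves {M a Λ s : ℝ} {ω : ℂ} {m : ℝ}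
    {lam : ℂ} (hsub : IsSubextremal M a Λ) (hω : ω.im = 0)
    (hlamBar : (lambdaBar a Λ s ω m lam).im = 0)
    (hF : FermionicTSCoerciveNegThreeHalves M a Λ s ω m lam)
    {R : ℝ → ℂ} (hR : IsRadialTeukolskySolution M a Λ s ω m lam R)
    (hin : IsIngoingAtEventHorizon M a Λ s ω m R) (hout : IsOutgoingAtCosmoHorizon M a Λ ω m R) :
    ∀ r ∈ Ioo (rPlus M a Λ) (rCosmo M a Λ), R r = 0 := by
  obtain ⟨rfl, hc⟩ := hF
  have hlam : lam.im = 0 := by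
    rw [← im_lambdaBar_of_real a Λ (-(3 / 2)) hω m lam]; exact hlamBar
  exact radial_negThreeHalves_real_eq_zero_of_coercive hsub hω hlam hc hR hin hout

end Literature.Geometry.Lorentzian.KerrDeSitter

end
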